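import Summits.CriticalPhenomena.PercolationContinuityZ3.Theorems.Transplant.FKConnectivityAllQApexMass
import HarnessLib

/-!
# Connectivity correlation inequalities for `φ_{w,q}`, every `q > 0` — PENDANT-HUB TOOLS (leaf lemmas and one-pair mass splits)

Support file (`--supports stmt-CriticalPhenomena-4575`), FK sub-lane `prim-bschramm-fk-3` (gen 7) of the post-continuity
programme; builds on p205010 (kernel theorem, internal audit signed; external expert review pending).  No definitions, no named
facts, no sorries; standard axioms.  Tools for `…AllQHubCovPendant.lean` (the degree-three reduction of the hub covariance bound):
reachability when every open pair at `x` is the single pair `xu` (`pendant_reachable_iff`: a leaf is never interior to a path;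
`pendant_reachable_hub_iff`: `x ↔ b` iff `xu` open and `u ↔ b` off `xu`), the almost-sure form of the pendant hypothesis, and the
one-pair mass splits `S_w(J_P ∩ E) = (w P) q⁻¹ S_{w[P↦0]}(E')` (open part at a pendant hub, via fk-1 g5's `sum_pendant_openPair`) and
`S_w(J_Pᶜ ∩ E) = (1 − w P) S_{w[P↦0]}(E)` (closed part, any pair).
[cite: Grimmett2006, Thm. (3.1)(a) (p. 37); §1.4 eq. (1.20) (p. 15)]
-/

noncomputable section

namespace Summit.CriticalPhenomena.PercolationContinuityZ3.Theorems

namespace FK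

open MeasureTheory Set Literature.Probability.LatticeModels Literature.Probability.Percolation
open Literature.Probability.Percolation.DecisionTree (ind ind_of_mem ind_of_not_mem ind_nonneg)
open scoped Classical symmDiff

variable {V : Type*} [Fintype V]

/-! ### Pendant hub: graph lemmas -/

omit [Fintype V] in
/-- If every open pair at `x` is `xu`, removing `xu` isolates `x`. [folklore] -/
theorem pendant_isolated_diff {ω : BondConfig V} {x u : V} (hω : ∀ e ∈ ω, x ∈ e → e = s(x, u)) :
    ∀ e ∈ ω \ {s(x, u)}, x ∉ e := by
  intro e he hxe
  exact he.2 (hω e he.1 hxe)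

omit [Fintype V] in
/-- The toggle of `xu` does not change `ω` off `xu`. [folklore] -/
theorem symmDiff_singleton_diff_self (ω : BondConfig V) (P : Sym2 V) : (ω ∆ {P}) \ {P} = ω \ {P} := by
  ext g
  simp only [Set.mem_sdiff, Set.mem_symmDiff, Set.mem_singleton_iff]
  tauto

omit [Fintype V] in
/-- **Pendant lemma 1**: if every open pair at `x` is `xu` (`x ≠ u`), then for `a, b ≠ x`: `a ↔ b` iff `a ↔ b` off `xu`
(a leaf is never an interior vertex of a path). [folklore] -/
theorem pendant_reachable_iff {ω : BondConfig V} {x u a b : V} (ha : a ≠ x) (hb : b ≠ x)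
    (hω : ∀ e ∈ ω, x ∈ e → e = s(x, u)) :
    (openGraph ω).Reachable a b ↔ (openGraph (ω \ {s(x, u)})).Reachable a b := by
  set ξ := ω \ {s(x, u)} with hξ
  have hiso := pendant_isolated_diff hω
  by_cases hP : s(x, u) ∈ ω
  · have hωeq : ω = insert s(x, u) ξ := by rw [hξ, Set.insert_sdiff_singleton, Set.insert_eq_of_mem hP]
    rw [hωeq, CoSunflowerGlue.openGraph_insert, CoSunflowerGlue.reachable_sup_edge_iff']
    constructor
    · rintro (h | ⟨h1, -⟩ | ⟨-, h2⟩)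
      · exact h
      · exact absurd h1 (not_reachable_of_isolated' hiso ha)
      · exact absurd h2 (not_reachable_of_isolated hiso hb)
    · exact fun h => Or.inl h
  · rw [hξ, Set.sdiff_singleton_eq_self hP]

omit [Fintype V] in
/-- **Pendant lemma 2**: if every open pair at `x` is `xu` (`x ≠ u`), then for `b ≠ x`: `x ↔ b` iff `xu` is open and `u ↔ b` off
`xu`. [folklore] -/
theorem pendant_reachable_hub_iff {ω : BondConfig V} {x u b : V} (hb : b ≠ x)
    (hω : ∀ e ∈ ω, x ∈ e → e = s(x, u)) :
    (openGraph ω).Reachable x b ↔ s(x, u) ∈ ω ∧ (openGraph (ω \ {s(x, u)})).Reachable u b := by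
  set ξ := ω \ {s(x, u)} with hξ
  have hiso := pendant_isolated_diff hω
  by_cases hP : s(x, u) ∈ ω
  · have hωeq : ω = insert s(x, u) ξ := by rw [hξ, Set.insert_sdiff_singleton, Set.insert_eq_of_mem hP]
    rw [hωeq, CoSunflowerGlue.openGraph_insert, CoSunflowerGlue.reachable_sup_edge_iff']
    simp only [Set.mem_insert_iff, true_or, true_and]
    constructor
    · rintro (h | ⟨-, h2⟩ | ⟨-, h2⟩)
      · exact absurd h (not_reachable_of_isolated hiso hb)
      · exact h2
      · exact absurd h2 (not_reachable_of_isolated hiso hb)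
    · exact fun h => Or.inr (Or.inl ⟨SimpleGraph.Reachable.refl _, h⟩)
  · rw [hξ, Set.sdiff_singleton_eq_self hP]
    simp only [hP, false_and, iff_false]
    have hiso' : ∀ e ∈ ω, x ∉ e := fun e he hxe => hP ((hω e he hxe) ▸ he)
    exact not_reachable_of_isolated hiso' hb

/-! ### Pendant hub: almost-sure bookkeeping -/

/-- The PENDANT HYPOTHESIS at `x` — every live pair at `x` is `xu` — holds almost surely as a statement about open pairs.
[cite: Grimmett2006, §1.4 eq. (1.20) (p. 15)] -/
theorem pendant_of_rcWeightW_ne_zero (w : Sym2 V → unitInterval) (q : ℝ) {x u : V}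
    (hw : ∀ e : Sym2 V, x ∈ e → ((w e : unitInterval) : ℝ) ≠ 0 → e = s(x, u)) {ω : BondConfig V}
    (hω : rcWeightW w q ∅ ω ≠ 0) : ∀ e ∈ ω, x ∈ e → e = s(x, u) := by
  intro e he hxe
  by_cases h0 : ((w e : unitInterval) : ℝ) = 0
  · exact absurd he (not_mem_of_rcWeightW_ne_zero w q h0 hω)
  · exact hw e hxe h0

omit [Fintype V] in
/-- The pendant hypothesis survives pinning `xu` to `0`. [folklore] -/
theorem pendant_hyp_update_zero {w : Sym2 V → unitInterval} {x u : V}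
    (hw : ∀ e : Sym2 V, x ∈ e → ((w e : unitInterval) : ℝ) ≠ 0 → e = s(x, u)) :
    ∀ e : Sym2 V, x ∈ e → ((Function.update w s(x, u) 0 e : unitInterval) : ℝ) ≠ 0 → e = s(x, u) := by
  intro e hxe hne
  by_cases he : e = s(x, u)
  · exact he
  · rw [Function.update_of_ne he] at hne
    exact hw e hxe hne

/-- **Open part at a pendant hub**: if every live pair at `x` is `P = xu` then `S_w(J_P ∩ E) = p·q⁻¹·S_{w[P ↦ 0]}(E')` whenever
`E ⟺ K` on `J_P` a.s. under `w` for a `P`-insensitive `K` with `K ⟺ E'` a.s. under `w[P ↦ 0]`. [cite: Grimmett2006, Thm. (3.1)(a) (p. 37)] -/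
theorem pendant_mass_open (w : Sym2 V → unitInterval) {q : ℝ} (hq : q ≠ 0) {x u y : V} (hxu : x ≠ u) (hxy : x ≠ y)
    (hyu : y ≠ u) (hw : ∀ e : Sym2 V, x ∈ e → ((w e : unitInterval) : ℝ) ≠ 0 → e = s(x, u))
    (h0 : ((w s(x, y) : unitInterval) : ℝ) = 0) (E K E' : Set (BondConfig V))
    (hK : ∀ ω : BondConfig V, ω ∆ {s(x, u)} ∈ K ↔ ω ∈ K)
    (hEK : ∀ ω : BondConfig V, rcWeightW w q ∅ ω ≠ 0 → s(x, u) ∈ ω → (ω ∈ E ↔ ω ∈ K))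
    (hKE' : ∀ ω : BondConfig V, rcWeightW (Function.update w s(x, u) 0) q ∅ ω ≠ 0 → (ω ∈ K ↔ ω ∈ E')) :
    ∑ ω : BondConfig V, rcWeightW w q ∅ ω * ind ({ω | s(x, u) ∈ ω} ∩ E) ω =
      ((w s(x, u) : unitInterval) : ℝ) * q⁻¹ * ∑ ω : BondConfig V, rcWeightW (Function.update w s(x, u) 0) q ∅ ω * ind E' ω := by
  have h1 : ∑ ω : BondConfig V, rcWeightW w q ∅ ω * ind ({ω | s(x, u) ∈ ω} ∩ E) ω =
      ∑ ω : BondConfig V, rcWeightW w q ∅ ω * ind ({ω | s(x, u) ∈ ω} ∩ K) ω := by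
    refine sum_rcWeightW_ind_congr_ae w q fun ω hω => ?_
    simp only [Set.mem_inter_iff, Set.mem_setOf_eq]
    constructor
    · rintro ⟨hP, hE⟩; exact ⟨hP, (hEK ω hω hP).1 hE⟩
    · rintro ⟨hP, hK'⟩; exact ⟨hP, (hEK ω hω hP).2 hK'⟩
  have hw' : ∀ e : Sym2 V, x ∈ e → ((w e : unitInterval) : ℝ) ≠ 0 → y ∈ e ∨ u ∈ e :=
    fun e hxe hne => Or.inr ((hw e hxe hne).symm ▸ Sym2.mem_mk_right x u)
  have ha : ((w s(y, x) : unitInterval) : ℝ) = 0 := by rw [Sym2.eq_swap]; exact h0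
  rw [h1, sum_pendant_openPair w hq hxy hxu hyu hw' ha K hK]
  congr 1
  exact sum_rcWeightW_ind_congr_ae _ q fun ω hω => hKE' ω hω

/-- The CLOSED part: `S_w(J_Pᶜ ∩ E) = (1 − w P)·S_{w[P ↦ 0]}(E)` for every pair `P` and event `E`.
[cite: Grimmett2006, §1.4 eq. (1.20) (p. 15); Thm. (3.1)(a) (p. 37)] -/
theorem sum_rcWeightW_ind_compl_openPair_inter (w : Sym2 V → unitInterval) (q : ℝ) (P : Sym2 V) (E : Set (BondConfig V)) :
    ∑ ω : BondConfig V, rcWeightW w q ∅ ω * ind ({ω | P ∈ ω}ᶜ ∩ E) ω =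
      (1 - ((w P : unitInterval) : ℝ)) * ∑ ω : BondConfig V, rcWeightW (Function.update w P 0) q ∅ ω * ind E ω := by
  rw [sum_rcWeightW_ind_affine w q P]
  have hz : ∑ ω : BondConfig V, rcWeightW (Function.update w P 1) q ∅ ω * ind ({ω | P ∈ ω}ᶜ ∩ E) ω = 0 := by
    refine Finset.sum_eq_zero fun ω _ => ?_
    by_cases hP : P ∈ ω
    · have : ω ∉ ({ω | P ∈ ω}ᶜ ∩ E : Set (BondConfig V)) := fun h => h.1 hP
      rw [ind_of_not_mem this, mul_zero]
    · rw [rcWeightW_eq_zero_of_one_not_mem _ q ∅ (by simp) hP, zero_mul]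
  have h0 : ∑ ω : BondConfig V, rcWeightW (Function.update w P 0) q ∅ ω * ind ({ω | P ∈ ω}ᶜ ∩ E) ω =
      ∑ ω : BondConfig V, rcWeightW (Function.update w P 0) q ∅ ω * ind E ω := by
    refine sum_rcWeightW_ind_congr_ae _ q fun ω hω => ?_
    have hP : P ∉ ω := not_mem_of_rcWeightW_ne_zero _ q (by simp) hω
    exact ⟨fun h => h.2, fun h => ⟨hP, h⟩⟩
  rw [hz, h0, mul_zero, add_zero]


end FK

end Summit.CriticalPhenomena.PercolationContinuityZ3.Theorems

end
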